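import Literature.NumberTheory.EllipticCurves.NeronModelLocal
import HarnessLib

/-!
# The Néron mapping property is local on the source; tensor form over a part of the base

Fifth infrastructure file of the existence programme for Néron models
(`Literature.NumberTheory.EllipticCurves.NeronModelExistence`; see `NeronModelBaseChange`,
`NeronModelGroupStructure`, `NeronModelLocal`, `NeronModelSchematic`). It collects the two formal
reductions used by the local criterion for the Néron property at a closed point
(`NeronModelLocalCriterion`, the verification step of the local-to-global passage of
Bosch–Lütkebohmert–Raynaud, *Néron Models*, §1.4):

* **locality on the source** (`bijective_map_of_isAffine`): for `a : T ⟶ S` and `𝒩` over `S`, if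
  `f ↦ f ×_S T` is bijective on `Hom_S(𝒳, 𝒩)` for every smooth `S`-scheme `𝒳` with *affine*
  total space, it is bijective for every smooth `S`-scheme `𝒳` — injectivity is checked on an
  open cover (`map_injective_of_openCover`), surjectivity by gluing extensions over an open cover
  whose pairwise intersections satisfy injectivity (`map_surjective_of_openCover`,
  Mathlib `Scheme.Cover.glueMorphisms`, and the open cover `𝒱 ×_S T` of `𝒳 ×_S T`,
  `Scheme.Pullback.openCoverOfLeft`). This is the remark that the Néron mapping property, being
  a sheaf condition for the Zariski topology on `𝒳`, may be checked on quasi-compact (affine)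
  `𝒳` — needed because the limit arguments of EGA IV₃ §8 (Mathlib `AffineTransitionLimit`)
  require quasi-compact and quasi-separated sources;
* **tensor form of the mapping property over a part of the base** (`bijective_map_tensor`): for a
  monomorphism `φ : S' ⟶ S` through which `a` factors (e.g. `Spec R_𝔭 → Spec R`, or an open
  immersion), the mapping property of `𝒩 ×_S S'` over `S'` for `𝒳 ×_S S'` gives the mapping
  property of `𝒩` along `a` for the `S`-scheme `𝒳 ⊗ (S' → S)` (Mathlib's cartesian monoidal
  structure on `Over S`), via `bijective_map_pullback_iff` of `NeronModelLocal` and the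
  isomorphism `mapPullbackObjIsoTensor : (𝒳 ×_S S' → S' → S) ≅ 𝒳 ⊗ (S' → S)`; and the first
  projection `𝒳 ⊗ (S' → S) ⟶ 𝒳` becomes an isomorphism after base change along `a`
  (`isIso_pullback_map_fst`).

Everything here is formal (no named facts); statements are for arbitrary schemes `S`, `T`.

## References

* S. Bosch, W. Lütkebohmert, M. Raynaud, *Néron Models*, Springer 1990, §1.2 (Def. 1, Prop. 4),
  §1.4. [BLRNeronModels1990]
* The Stacks project, Tag 01LH (relative gluing) and Tag 01ZC (limits and morphisms of finite
  presentation). [StacksProject]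
-/

noncomputable section

universe u

namespace Literature.NumberTheory.EllipticCurves

open _root_.AlgebraicGeometry CategoryTheory Limits MonoidalCategory CartesianMonoidalCategory
open scoped CategoryTheory.Obj

/-! ### The mapping property is local on the source -/

section SourceLocal

variable {S T : Scheme.{u}} (a : T ⟶ S) (𝒩 : Over S)

/-- Injectivity of `f ↦ f ×_S T` on `Hom_S(𝒳, 𝒩)` can be checked on an open cover of `𝒳`
(two morphisms agreeing on an open cover agree). [folklore] -/
theorem map_injective_of_openCover (𝒳 : Over S) (𝒱 : 𝒳.left.OpenCover)
    (H : ∀ j, Function.Injective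
      fun f : Over.mk (𝒱.f j ≫ 𝒳.hom) ⟶ 𝒩 => (Over.pullback a).map f) :
    Function.Injective fun f : 𝒳 ⟶ 𝒩 => (Over.pullback a).map f := by
  intro f g hfg
  have hfg' : (Over.pullback a).map f = (Over.pullback a).map g := hfg
  ext : 1
  refine Scheme.Cover.hom_ext 𝒱 _ _ fun j => ?_
  let ι : Over.mk (𝒱.f j ≫ 𝒳.hom) ⟶ 𝒳 := Over.homMk (𝒱.f j) rfl
  have key : ι ≫ f = ι ≫ g := H j (by
    change (Over.pullback a).map (ι ≫ f) = (Over.pullback a).map (ι ≫ g)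
    rw [Functor.map_comp, Functor.map_comp, hfg'])
  exact congrArg CommaMorphism.left key

/-- Surjectivity of `f ↦ f ×_S T` on `Hom_S(𝒳, 𝒩)` follows from surjectivity on the members of
an open cover `𝒱` of `𝒳` and injectivity on their pairwise intersections: extend on each member,
the extensions agree on overlaps by injectivity, glue (`Scheme.Cover.glueMorphisms`), and compare
with the given morphism on the open cover `𝒱 ×_S T` of `𝒳 ×_S T`
(`Scheme.Pullback.openCoverOfLeft`). [folklore] -/
theorem map_surjective_of_openCover (𝒳 : Over S) (𝒱 : 𝒳.left.OpenCover)
    (Hinj : ∀ i j, Function.Injective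
      fun f : Over.mk ((pullback.fst (𝒱.f i) (𝒱.f j) ≫ 𝒱.f i) ≫ 𝒳.hom) ⟶ 𝒩 =>
        (Over.pullback a).map f)
    (Hsurj : ∀ j, Function.Surjective
      fun f : Over.mk (𝒱.f j ≫ 𝒳.hom) ⟶ 𝒩 => (Over.pullback a).map f) :
    Function.Surjective fun f : 𝒳 ⟶ 𝒩 => (Over.pullback a).map f := by
  intro u
  let V : 𝒱.I₀ → Over S := fun j => Over.mk (𝒱.f j ≫ 𝒳.hom)
  let ι : ∀ j, V j ⟶ 𝒳 := fun j => Over.homMk (𝒱.f j) rfl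
  choose g hg using fun j => Hsurj j ((Over.pullback a).map (ι j) ≫ u)
  have hg' : ∀ j, (Over.pullback a).map (g j) = (Over.pullback a).map (ι j) ≫ u := hg
  have hcompat : ∀ i j, pullback.fst (𝒱.f i) (𝒱.f j) ≫ (g i).left =
      pullback.snd (𝒱.f i) (𝒱.f j) ≫ (g j).left := by
    intro i j
    let W : Over S := Over.mk ((pullback.fst (𝒱.f i) (𝒱.f j) ≫ 𝒱.f i) ≫ 𝒳.hom)
    let p₁ : W ⟶ V i := Over.homMk (pullback.fst (𝒱.f i) (𝒱.f j)) (Category.assoc _ _ _).symm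
    let p₂ : W ⟶ V j := Over.homMk (pullback.snd (𝒱.f i) (𝒱.f j)) (by
      change pullback.snd _ _ ≫ 𝒱.f j ≫ 𝒳.hom = (pullback.fst _ _ ≫ 𝒱.f i) ≫ 𝒳.hom
      rw [Category.assoc, pullback.condition_assoc])
    have hp : p₁ ≫ ι i = p₂ ≫ ι j := by
      ext : 1
      exact pullback.condition
    have key : p₁ ≫ g i = p₂ ≫ g j := Hinj i j (by
      change (Over.pullback a).map (p₁ ≫ g i) = (Over.pullback a).map (p₂ ≫ g j)
      simp only [Functor.map_comp, hg']
      rw [← Category.assoc, ← Category.assoc, ← Functor.map_comp, ← Functor.map_comp, hp])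
    exact congrArg CommaMorphism.left key
  let gl : 𝒳.left ⟶ 𝒩.left := Scheme.Cover.glueMorphisms 𝒱 (fun j => (g j).left) hcompat
  have hgl : ∀ j, 𝒱.f j ≫ gl = (g j).left := fun j => Scheme.Cover.ι_glueMorphisms 𝒱 _ hcompat j
  have hover : gl ≫ 𝒩.hom = 𝒳.hom := by
    refine Scheme.Cover.hom_ext 𝒱 _ _ fun j => ?_
    rw [← Category.assoc, hgl]
    exact Over.w (g j)
  refine ⟨Over.homMk gl hover, ?_⟩
  have hι : ∀ j, ι j ≫ Over.homMk gl hover = g j := fun j => by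
    ext : 1
    exact hgl j
  change (Over.pullback a).map (Over.homMk gl hover) = u
  ext : 1
  refine Scheme.Cover.hom_ext (Scheme.Pullback.openCoverOfLeft 𝒱 𝒳.hom a) _ _ fun j => ?_
  have hcov : (Scheme.Pullback.openCoverOfLeft 𝒱 𝒳.hom a).f j =
      ((Over.pullback a).map (ι j)).left := by
    apply pullback.hom_ext
    · exact (pullback.lift_fst _ _ _).trans (pullback.lift_fst _ _ _).symm
    · exact (pullback.lift_snd _ _ _).trans
        ((Category.comp_id _).trans (pullback.lift_snd _ _ _).symm)
  have key : (Over.pullback a).map (ι j) ≫ (Over.pullback a).map (Over.homMk gl hover) =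
      (Over.pullback a).map (ι j) ≫ u := by
    rw [← Functor.map_comp, hι, hg']
  rw [hcov]
  have key' := congrArg CommaMorphism.left key
  simp only [Over.comp_left] at key'
  exact key'

/-- **The Néron mapping property is local on the source**: if `f ↦ f ×_S T` is bijective on
`Hom_S(𝒳, 𝒩)` for every smooth `S`-scheme `𝒳` *with affine total space*, then it is bijective
for every smooth `S`-scheme `𝒳` (injectivity via the affine open cover of `𝒳`; then surjectivity
by gluing, the overlaps being smooth). [folklore] -/
theorem bijective_map_of_isAffine
    (H : ∀ 𝒳 : Over S, Smooth 𝒳.hom → IsAffine 𝒳.left →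
      Function.Bijective fun f : 𝒳 ⟶ 𝒩 => (Over.pullback a).map f)
    (𝒳 : Over S) (h𝒳 : Smooth 𝒳.hom) :
    Function.Bijective fun f : 𝒳 ⟶ 𝒩 => (Over.pullback a).map f := by
  have hinj : ∀ 𝒴 : Over S, Smooth 𝒴.hom →
      Function.Injective fun f : 𝒴 ⟶ 𝒩 => (Over.pullback a).map f := by
    intro 𝒴 h𝒴
    refine map_injective_of_openCover a 𝒩 𝒴 𝒴.left.affineCover fun j =>
      (H _ ?_ (inferInstanceAs (IsAffine (𝒴.left.affineCover.X j)))).1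
    change Smooth (𝒴.left.affineCover.f j ≫ 𝒴.hom)
    exact MorphismProperty.comp_mem _ _ _ inferInstance h𝒴
  refine ⟨hinj 𝒳 h𝒳, map_surjective_of_openCover a 𝒩 𝒳 𝒳.left.affineCover ?_ ?_⟩
  · intro i j
    refine hinj _ ?_
    change Smooth ((pullback.fst _ _ ≫ 𝒳.left.affineCover.f i) ≫ 𝒳.hom)
    exact MorphismProperty.comp_mem _ _ _ inferInstance h𝒳
  · intro j
    refine (H _ ?_ (inferInstanceAs (IsAffine (𝒳.left.affineCover.X j)))).2
    change Smooth (𝒳.left.affineCover.f j ≫ 𝒳.hom)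
    exact MorphismProperty.comp_mem _ _ _ inferInstance h𝒳

end SourceLocal

/-! ### The projection `𝒳 ⊗ T ⟶ 𝒳` for `T → S` a monomorphism -/

section TensorMono

variable {S S' T : Scheme.{u}} (φ : S' ⟶ S) [Mono φ] (a' : T ⟶ S')

/-- `(𝒳 ×_S S' → S' → S) ≅ 𝒳 ⊗ (S' → S)` over `S` (same total space `𝒳 ×_S S'`, the two structure
maps agree by the pullback condition). [folklore] -/
def mapPullbackObjIsoTensor (𝒳 : Over S) :
    (Over.map φ).obj ((Over.pullback φ).obj 𝒳) ≅ 𝒳 ⊗ Over.mk φ :=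
  Over.isoMk (Iso.refl _) (by
    change 𝟙 _ ≫ pullback.fst 𝒳.hom φ ≫ 𝒳.hom = pullback.snd 𝒳.hom φ ≫ φ
    rw [Category.id_comp, pullback.condition])

omit [Mono φ] in
/-- Under `mapPullbackObjIsoTensor` the counit `(𝒳 ×_S S' → S) ⟶ 𝒳` is the first projection.
[folklore] -/
theorem mapPullbackObjIsoTensor_hom_fst (𝒳 : Over S) :
    (mapPullbackObjIsoTensor φ 𝒳).hom ≫ fst 𝒳 (Over.mk φ) =
      (Over.mapPullbackAdj φ).counit.app 𝒳 := by
  ext : 1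
  have h2 : ((Over.mapPullbackAdj φ).counit.app 𝒳).left = pullback.fst 𝒳.hom φ := by
    simp [Over.mapPullbackAdj_counit_app]
  change 𝟙 _ ≫ (fst 𝒳 (Over.mk φ)).left = _
  rw [Over.fst_left, Category.id_comp, h2]
  rfl

/-- For a monomorphism `φ : S' ⟶ S` through which `a = a' ≫ φ` factors, the first projection
`𝒳 ⊗ (S' → S) ⟶ 𝒳` becomes an isomorphism after base change along `a`
(`isIso_pullback_map_counit`). [folklore] -/
theorem isIso_pullback_map_fst {a : T ⟶ S} (ha : a' ≫ φ = a) (𝒳 : Over S) :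
    IsIso ((Over.pullback a).map (fst 𝒳 (Over.mk φ))) := by
  have h0 := isIso_pullback_map_counit φ a' ha 𝒳
  have h1 : IsIso ((Over.pullback a).map
      ((mapPullbackObjIsoTensor φ 𝒳).hom ≫ fst 𝒳 (Over.mk φ))) := by
    rw [mapPullbackObjIsoTensor_hom_fst]
    exact h0
  rw [Functor.map_comp] at h1
  exact @IsIso.of_isIso_comp_left _ _ _ _ _
    ((Over.pullback a).map (mapPullbackObjIsoTensor φ 𝒳).hom) _ inferInstance h1

/-- **The mapping property over a part `S' → S` of the base (a monomorphism), tensor form.** If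
`𝒩 ×_S S'` has the mapping property over `S'` for the smooth `S'`-scheme `𝒳 ×_S S'` (base change
along `a'` bijective on `Hom_{S'}(𝒳 ×_S S', 𝒩 ×_S S')`), then base change along `a = a' ≫ φ` is
bijective on `Hom_S(𝒳 ⊗ (S' → S), 𝒩)` (`bijective_map_pullback_iff` transported along
`mapPullbackObjIsoTensor`). [folklore] -/
theorem bijective_map_tensor {a : T ⟶ S} (ha : a' ≫ φ = a) (𝒩 𝒳 : Over S)
    (H : Function.Bijective fun f' : (Over.pullback φ).obj 𝒳 ⟶ (Over.pullback φ).obj 𝒩 =>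
      (Over.pullback a').map f') :
    Function.Bijective fun f : 𝒳 ⊗ Over.mk φ ⟶ 𝒩 => (Over.pullback a).map f := by
  subst ha
  rw [← bijective_map_iff_of_iso (a' ≫ φ) 𝒩 (mapPullbackObjIsoTensor φ 𝒳)]
  exact (bijective_map_pullback_iff φ a' 𝒩 ((Over.pullback φ).obj 𝒳)).mpr H

end TensorMono

end Literature.NumberTheory.EllipticCurves

end
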